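import Summits.PneNP.PneNP.Theorems.NegLimitedRazborovDichotomyLive
import Literature.Barriers.PneNP.NegationLimitedGapSingleOutputSqrtLog

/-!
# Route NegLimited — T1: NOT budget `Θ(log m / log log m)` for every `(⌊√m⌋-1, ⌊√m⌋)`-clique-like function (rung F-N1/p3, steps S3–S4)

* `cliqueLikeNegLimitedLog` (**T1**): for every `k`, eventually in `m`, every De Morgan circuit
  computing a `(⌊√m⌋-1, ⌊√m⌋)`-clique-like function `F` with at most
  `logBudget m = ⌊log₂ m⌋ / (20 (⌊log₂ ⌊log₂ m⌋⌋ + 1))` NOT gates has at least `m^k` gates;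
  `cliqueFnNegLimitedLog` (**T2**, `F = CLIQUE(m, ⌊√m⌋)`). Print record: `(1/6) log log m`
  (Amano–Maruoka 2005, the tree's `amano_maruoka` / `cliqueLike_sqrt_negationLimited`); tree
  record before this file: `Θ(√(log m) / log log m)` (`cliqueLike_sqrt_negationLimited_sqrtLog`).
* S3 = `cliqueLike_induction_ab`, `le_size_of_cliqueLike_ab`, `cliqueLikeFiniteAB`: the
  Amano–Maruoka induction (`cliqueLike_induction`) run on `razborovDichotomyLive` — each NOT gate
  costs a live-set shrink by the factor `c` and `c` colours of slack, uniformly along the induction.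
* S4 = `params_ok` + assembly: `L = ⌊log₂ m⌋`, `K = ⌊log₂ L⌋`, `l = (k+1)(L+1)`,
  `r = (k+1)(L+1)(L+2)+1`, `c = 4 r²`, `s = ⌊√m⌋`; all side conditions hold once
  `K ≥ max (2 (⌊log₂ (k+1)⌋+1) + 5) 8` — exponent bookkeeping in `ℕ`.
Cell record: HOME/pnp-ideate-p3/PortNegLimLog.lean (referee PASS).
-/

set_option linter.dupNamespace false -- `Summit.PneNP.PneNP.…`: summit = sub-problem name (D-0017 single-conjunct layout)

namespace Summit.PneNP.PneNP.Theorems.NegLimLog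

open Finset Literature.Computability.Complexity Literature.Computability.Complexity.GateList
  Literature.Computability.Complexity.Razborov

variable {m : ℕ}

/-! ### Port step S3: the Amano–Maruoka induction with the Alon–Boppana engine

Verbatim the tree's `cliqueLike_noNot_false` / `cliqueLike_induction` / `le_size_of_computes_cliqueFn`
(AmanoMaruokaProofs.lean) with `clique_dichotomy` replaced by `razborovDichotomyLive` and the clique
parameter `q = #V / c` at every step. -/

/-- **Base case**: a NOT-free program computing an `(a, b)`-clique function on `V` violates the
Alon–Boppana dichotomy. -/
theorem cliqueLike_noNot_false_ab {a b c l r q : ℕ} (hr : 2 ≤ r) (hl : 2 ≤ l) (h4 : 4 * (r - 1) ≤ c)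
    (gs : List (Gate (KEdge m))) (o : KEdge m ⊕ ℕ) (V : Finset (Fin m))
    (F : (KEdge m → Bool) → Bool) (hwf : WF gs)
    (hB : ∀ g ∈ gs, g.fn ∈ deMorganBasis01) (ho : OutOK gs.length o) (hnegs : negs gs = 0)
    (hF : ∀ x, wireOf x (vals gs x) o = F x) (hCL : CliqueLike V a b F)
    (hA : (gs.length + 2) * (m + 1) ^ l * (l ^ 2) ^ r < c ^ r)
    (hB' : 2 * ((gs.length + 2) * ((r - 1) ^ l) ^ 2) < c ^ (l + 1))
    (hlq : l < q) (hq : q * c ≤ #V) (hbq : b ≤ q) (hca : c ≤ a) : False := by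
  rcases razborovDichotomyLive m gs hwf (isOver_monotoneBasis01_of_negs_eq_zero hB hnegs) o ho V c l r q
      hr hl hlq hq h4 hA hB' with ⟨h, hh⟩ | ⟨Q, hQV, hQ, hQ0⟩
  · rw [hF, hCL.rejects_of_le hca h] at hh
    exact Bool.false_ne_true hh
  · rw [hF, hCL.accepts_of_le hQV (hQ ▸ hbq)] at hQ0
    exact Bool.false_ne_true hQ0.symm

/-- **The induction** (Amano–Maruoka restriction scheme, Alon–Boppana engine). Fix `r ≥ 2`,
`2 ≤ l < b`, `4 (r-1) ≤ c` and the two numeric side conditions at program length `T + 2`. Then no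
well-formed program over `{∧₂, ∨₂, ¬, 0, 1}` with at most `R` NOT gates and `|gs| + 2R ≤ T` gates
computes an `(a, b)`-clique function on a live set `V` with `b ≤ #V / c^(R+1)` and `(R+1) c ≤ a`. -/
theorem cliqueLike_induction_ab {b c l r T : ℕ} (hr : 2 ≤ r) (hl : 2 ≤ l) (hlb : l < b)
    (h4 : 4 * (r - 1) ≤ c) (hTA : (T + 2) * (m + 1) ^ l * (l ^ 2) ^ r < c ^ r)
    (hTB : 2 * ((T + 2) * ((r - 1) ^ l) ^ 2) < c ^ (l + 1)) :
    ∀ (R : ℕ) (gs : List (Gate (KEdge m))) (o : KEdge m ⊕ ℕ) (V : Finset (Fin m)) (a : ℕ)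
      (F : (KEdge m → Bool) → Bool),
      WF gs → (∀ g ∈ gs, g.fn ∈ deMorganBasis01) → OutOK gs.length o → negs gs ≤ R →
      (∀ x, wireOf x (vals gs x) o = F x) → CliqueLike V a b F →
      gs.length + 2 * R ≤ T → b ≤ #V / c ^ (R + 1) → (R + 1) * c ≤ a → False := by
  have hc : 1 ≤ c := by omega
  -- numeric consequences of `L + 2 ≤ T + 2`
  have hnum : ∀ L : ℕ, L ≤ T → (L + 2) * (m + 1) ^ l * (l ^ 2) ^ r < c ^ r ∧
      2 * ((L + 2) * ((r - 1) ^ l) ^ 2) < c ^ (l + 1) := by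
    intro L hL
    refine ⟨lt_of_le_of_lt ?_ hTA, lt_of_le_of_lt ?_ hTB⟩
    · gcongr
    · gcongr
  -- `b ≤ #V / c^(R+1)` gives `b ≤ #V / c`
  have hdiv : ∀ (n R : ℕ), b ≤ n / c ^ (R + 1) → b ≤ n / c := fun n R h =>
    h.trans (Nat.div_le_div_left (Nat.le_self_pow (by omega) c) (by omega))
  intro R
  induction R with
  | zero =>
    intro gs o V a F hwf hB ho hnegs hF hCL hlen hbV hca
    obtain ⟨h1, h0⟩ := hnum gs.length (by omega)
    have hbq := hdiv _ _ hbV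
    exact cliqueLike_noNot_false_ab hr hl h4 gs o V F hwf hB ho (Nat.le_zero.1 hnegs) hF hCL h1 h0
      (lt_of_lt_of_le hlb hbq) (Nat.div_mul_le_self _ _) hbq (by simpa using hca)
  | succ R ih =>
    intro gs o V a F hwf hB ho hnegs hF hCL hlen hbV hca
    have hbq := hdiv _ _ hbV
    have hca1 : c ≤ a := le_trans (Nat.le_mul_of_pos_left c (by omega)) hca
    by_cases hn : negs gs = 0
    · obtain ⟨h1, h0⟩ := hnum gs.length (by omega)
      exact cliqueLike_noNot_false_ab hr hl h4 gs o V F hwf hB ho hn hF hCL h1 h0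
        (lt_of_lt_of_le hlb hbq) (Nat.div_mul_le_self _ _) hbq hca1
    -- the first NOT gate and the monotone function feeding it
    obtain ⟨pre, w₀, post, rfl, hpre⟩ := exists_first_notGate hn
    have hwfpre : WF pre := hwf.of_append_left
    have hBpre : ∀ g ∈ pre, g.fn ∈ monotoneBasis01 := fun g hg =>
      mem_monotoneBasis01_of_ne_not (hB g (by simp [hg])) (hpre g hg)
    have hw₀ : OutOK pre.length w₀ := fun n hn => hwf.gateOK_mid (0 : Fin 1) n hn
    have hgmono : Monotone fun x => wireOf x (vals pre x) w₀ :=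
      monotone_wireOf_vals01 pre hwfpre hBpre w₀ hw₀
    obtain ⟨h1, h0⟩ := hnum pre.length (by simp at hlen; omega)
    -- the dichotomy on the prefix, with `q = #V / c`
    rcases razborovDichotomyLive m pre hwfpre hBpre w₀ hw₀ V c l r (#V / c) hr hl
        (lt_of_lt_of_le hlb hbq) (Nat.div_mul_le_self _ _) h4 h1 h0 with ⟨h, hh⟩ | ⟨Q, hQV, hQcard, hQ0⟩
    · -- type 1: restrict to a monochromatic part of size `#V / c`
      obtain ⟨k, W, hWV, hWcard, hWmono⟩ := exists_mono_subset hc V h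
      have hconst : ∀ x, wireOf (select W (colorTest V h) x)
          (vals pre (select W (colorTest V h) x)) w₀ = true := fun x =>
        apply_select_colorTest_eq_true hgmono hWV hWmono hh x
      obtain ⟨gs', o', hwf', hB', hlen', hnegs', ho', hF'⟩ :=
        killFirstNot W (colorTest V h) pre post w₀ o F true hwf hB ho hF hconst
      refine ih gs' o' W (a - c) _ hwf' hB' ho' (by omega) hF' (hCL.restrictColor hWV hca1 h)
        (by omega) ?_ ?_
      · rw [hWcard, Nat.div_div_eq_div_mul, ← pow_succ']
        exact hbV
      · have : (R + 1 + 1) * c = (R + 1) * c + c := by ring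
        omega
    · -- type 0: restrict to the clique `Q` of size `#V / c`
      have hconst : ∀ x, wireOf (select Q (fun _ => false) x)
          (vals pre (select Q (fun _ => false) x)) w₀ = false := fun x =>
        apply_select_bot_eq_false hgmono hQ0 x
      obtain ⟨gs', o', hwf', hB', hlen', hnegs', ho', hF'⟩ :=
        killFirstNot Q (fun _ => false) pre post w₀ o F false hwf hB ho hF hconst
      refine ih gs' o' Q a _ hwf' hB' ho' (by omega) hF' (hCL.restrictClique hQV) (by omega) ?_ ?_
      · rw [hQcard, Nat.div_div_eq_div_mul, ← pow_succ']
        exact hbV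
      · have : (R + 1 + 1) * c = (R + 1) * c + c := by ring
        omega

/-- **F1, the finite lower bound** (port step S3 complete). Let `r ≥ 2`, `2 ≤ l < s`,
`4 (r-1) ≤ c`, the side conditions (A), (B) at `T = m^k + 2R`, `s ≤ m / c^(R+1)` and
`(R+1) c ≤ s - 1`. Then every circuit over `{∧₂, ∨₂, ¬}` with at most `R` NOT gates computing an
`(s-1, s)`-clique function on all of `K_m` has at least `m^k` gates. -/
theorem le_size_of_cliqueLike_ab {m s k R c l r : ℕ} (hr : 2 ≤ r) (hl : 2 ≤ l) (hls : l < s)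
    (h4 : 4 * (r - 1) ≤ c)
    (hA : (m ^ k + 2 * R + 2) * (m + 1) ^ l * (l ^ 2) ^ r < c ^ r)
    (hB : 2 * ((m ^ k + 2 * R + 2) * ((r - 1) ^ l) ^ 2) < c ^ (l + 1))
    (hsm : s ≤ m / c ^ (R + 1)) (hRs : (R + 1) * c ≤ s - 1)
    (F : (KEdge m → Bool) → Bool) (hCL : CliqueLike (univ : Finset (Fin m)) (s - 1) s F)
    (C : Circuit (KEdge m)) (hC : C.IsOver deMorganBasis)
    (hcomp : C.Computes F) (hneg : C.negationCount ≤ R) : m ^ k ≤ C.size := by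
  by_contra hlt
  push Not at hlt
  refine cliqueLike_induction_ab (m := m) (T := m ^ k + 2 * R) hr hl hls h4 hA hB R C.gates
    C.output univ (s - 1) F (wf_gates C)
    (fun g hg => deMorganBasis_subset_deMorganBasis01 (hC g hg)) C.wf_output
    (by rw [← circuit_negationCount]; exact hneg) (fun x => by rw [← circuit_eval]; exact hcomp x)
    hCL ?_ ?_ hRs
  · have : C.gates.length = C.size := rfl
    omega
  · simpa using hsm

/-- `F1` in the exact shape typed in HOME/pnp-ideate-p3/Sketch-NegLimLog.lean (`CliqueLikeFiniteAB`). -/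
theorem cliqueLikeFiniteAB :
    ∀ (m s k R c l r : ℕ), 2 ≤ r → 2 ≤ l → l < s → 4 * (r - 1) ≤ c →
    (m ^ k + 2 * R + 2) * (m + 1) ^ l * (l ^ 2) ^ r < c ^ r →
    2 * ((m ^ k + 2 * R + 2) * ((r - 1) ^ l) ^ 2) < c ^ (l + 1) →
    s ≤ m / c ^ (R + 1) → (R + 1) * c ≤ s - 1 →
    ∀ F : (KEdge m → Bool) → Bool, CliqueLike (univ : Finset (Fin m)) (s - 1) s F →
    ∀ C : Circuit (KEdge m), C.IsOver deMorganBasis → C.Computes F →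
      C.negationCount ≤ R → m ^ k ≤ C.size :=
  fun _ _ _ _ _ _ _ hr hl hls h4 hA hB hsm hRs F hCL C hC hcomp hneg =>
    le_size_of_cliqueLike_ab hr hl hls h4 hA hB hsm hRs F hCL C hC hcomp hneg

/-! ### Port step S4: parameters and asymptotics

With `L = ⌊log₂ m⌋`, `K = ⌊log₂ L⌋`, `R = ⌊L / (20 (K+1))⌋`, the parameters are
`l = (k+1)(L+1)`, `r = (k+1)(L+1) + 1 + (L+1) l = (k+1)(L+1)(L+2) + 1`, `c = 4 r²`, `s = ⌊√m⌋`;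
all side conditions of `le_size_of_cliqueLike_ab` then hold as soon as
`K ≥ max (2 (⌊log₂ (k+1)⌋ + 1) + 5) 8`, by elementary exponent bookkeeping (no real analysis). -/

/-- The NOT budget `⌊L / (20 (K + 1))⌋`, `L = ⌊log₂ m⌋`, `K = ⌊log₂ L⌋` — `Θ(log m / log log m)`. -/
def logBudget (m : ℕ) : ℕ := Nat.log 2 m / (20 * (Nat.log 2 (Nat.log 2 m) + 1))

/-- The lattice parameter `l = (k+1)(L+1)`. -/
def pl (k L : ℕ) : ℕ := (k + 1) * (L + 1)

/-- The sunflower parameter `r = (k+1)(L+1) + 1 + (L+1) l`. -/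
def pr (k L : ℕ) : ℕ := (k + 1) * (L + 1) + 1 + (L + 1) * pl k L

/-- The number of colours `c = 4 r²`. -/
def pc (k L : ℕ) : ℕ := 4 * pr k L ^ 2

/-- Closed form of the parameter `r`: `pr k L = (k+1)(L+1)(L+2)+1`. -/
theorem pr_eq (k L : ℕ) : pr k L = (k + 1) * (L + 1) * (L + 2) + 1 := by
  unfold pr pl; ring

/-- `1 ≤ pl k L`. -/
theorem one_le_pl (k L : ℕ) : 1 ≤ pl k L := by
  unfold pl; nlinarith [Nat.zero_le k, Nat.zero_le L]

/-- `pl k L < pr k L`. -/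
theorem pl_lt_pr (k L : ℕ) : pl k L < pr k L := by
  have h := one_le_pl k L
  unfold pr
  unfold pl at h ⊢
  nlinarith [Nat.zero_le ((L + 1) * ((k + 1) * (L + 1)))]

/-- `2 ≤ pr k L`. -/
theorem two_le_pr (k L : ℕ) : 2 ≤ pr k L := by
  have h1 := one_le_pl k L
  have h2 := pl_lt_pr k L
  omega

/-- `pr k L ≤ pc k L`. -/
theorem pr_le_pc (k L : ℕ) : pr k L ≤ pc k L := by
  unfold pc; nlinarith [two_le_pr k L]

/-- `2 ≤ pc k L`. -/
theorem two_le_pc (k L : ℕ) : 2 ≤ pc k L := (two_le_pr k L).trans (pr_le_pc k L)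

/-- `20 K + 24 ≤ 2^K` for `K ≥ 8`. -/
theorem twenty_mul_add_le_two_pow {K : ℕ} (hK : 8 ≤ K) : 20 * K + 24 ≤ 2 ^ K := by
  induction K, hK using Nat.le_induction with
  | base => norm_num
  | succ K hK ih =>
    have h20 : 20 ≤ 2 ^ K := le_trans (by norm_num) (Nat.pow_le_pow_right (by norm_num) hK)
    rw [pow_succ]
    omega

/-- `c ≤ 2^E` with `E = 4K + 2κ + 10`, `κ = ⌊log₂(k+1)⌋ + 1`, whenever `L < 2^(K+1)`. -/
theorem pc_le_two_pow {k L K : ℕ} (hLK : L < 2 ^ (K + 1)) :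
    pc k L ≤ 2 ^ (4 * K + 2 * (Nat.log 2 (k + 1) + 1) + 10) := by
  set κ := Nat.log 2 (k + 1) + 1 with hκ
  have hk : k + 1 ≤ 2 ^ κ := (Nat.lt_pow_succ_log_self one_lt_two (k + 1)).le
  have hL2 : L + 2 ≤ 2 ^ (K + 2) := by rw [pow_succ]; omega
  have hr : pr k L ≤ 2 ^ κ * (2 ^ (K + 2)) ^ 2 := by
    rw [pr_eq]
    calc (k + 1) * (L + 1) * (L + 2) + 1 ≤ (k + 1) * (L + 2) ^ 2 := by nlinarith [Nat.zero_le k, Nat.zero_le L]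
      _ ≤ 2 ^ κ * (2 ^ (K + 2)) ^ 2 := Nat.mul_le_mul hk (Nat.pow_le_pow_left hL2 2)
  have hr' : pr k L ≤ 2 ^ (κ + 2 * (K + 2)) := by
    rw [pow_add, pow_mul']
    exact hr
  unfold pc
  calc 4 * pr k L ^ 2 ≤ 4 * (2 ^ (κ + 2 * (K + 2))) ^ 2 := by gcongr
    _ = 2 ^ (4 * K + 2 * κ + 10) := by
        rw [← pow_mul, show (4 : ℕ) = 2 ^ 2 by norm_num, ← pow_add]
        congr 1; ring

/-- **The side conditions hold eventually.** `L = ⌊log₂ m⌋`, `K = ⌊log₂ L⌋`,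
`R = ⌊L / (20 (K+1))⌋` are passed as opaque naturals with their defining equations. -/
theorem params_ok {k m L K R : ℕ} (hLm : Nat.log 2 m = L) (hKL : Nat.log 2 L = K)
    (hRd : R = L / (20 * (K + 1)))
    (hK : max (2 * (Nat.log 2 (k + 1) + 1) + 5) 8 ≤ K) :
    2 ≤ pr k L ∧ 2 ≤ pl k L ∧ pl k L < Nat.sqrt m ∧ 4 * (pr k L - 1) ≤ pc k L ∧
    (m ^ k + 2 * R + 2) * (m + 1) ^ pl k L * (pl k L ^ 2) ^ pr k L < pc k L ^ pr k L ∧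
    2 * ((m ^ k + 2 * R + 2) * ((pr k L - 1) ^ pl k L) ^ 2) < pc k L ^ (pl k L + 1) ∧
    Nat.sqrt m ≤ m / pc k L ^ (R + 1) ∧ (R + 1) * pc k L ≤ Nat.sqrt m - 1 := by
  obtain ⟨κ, hκ⟩ : ∃ κ, Nat.log 2 (k + 1) + 1 = κ := ⟨_, rfl⟩
  obtain ⟨E, hE⟩ : ∃ E, 4 * K + 2 * κ + 10 = E := ⟨_, rfl⟩
  rw [hκ] at hK
  -- basic ranges
  have hK8 : 8 ≤ K := le_trans (le_max_right _ _) hK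
  have hKκ : 2 * κ + 5 ≤ K := le_trans (le_max_left _ _) hK
  have hL0 : L ≠ 0 := by
    rintro rfl
    rw [Nat.log_zero_right] at hKL
    omega
  have hm0 : m ≠ 0 := by
    rintro rfl
    rw [Nat.log_zero_right] at hLm
    exact hL0 hLm.symm
  have h2K : 2 ^ K ≤ L := hKL ▸ Nat.pow_log_le_self 2 hL0
  have hLK : L < 2 ^ (K + 1) := hKL ▸ Nat.lt_pow_succ_log_self one_lt_two L
  have h2L : 2 ^ L ≤ m := hLm ▸ Nat.pow_log_le_self 2 hm0
  have hmL : m < 2 ^ (L + 1) := hLm ▸ Nat.lt_pow_succ_log_self one_lt_two m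
  have hE5 : E ≤ 5 * (K + 1) := by omega
  have hEL : 4 * E + 4 ≤ L := by have := twenty_mul_add_le_two_pow hK8; omega
  -- the parameters
  have hr2 : 2 ≤ pr k L := two_le_pr k L
  have hl1 : 1 ≤ pl k L := one_le_pl k L
  have hlL : L + 1 ≤ pl k L := Nat.le_mul_of_pos_left (L + 1) (Nat.succ_pos k)
  have hlr : pl k L < pr k L := pl_lt_pr k L
  have hc2 : 2 ≤ pc k L := two_le_pc k L
  have hrc : pr k L ≤ pc k L := pr_le_pc k L
  have hcE : pc k L ≤ 2 ^ E := by
    have h := pc_le_two_pow (k := k) hLK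
    rwa [hκ, hE] at h
  -- the budget: `2 (E R + E + 1) ≤ L`
  have hRL : R ≤ L := hRd ▸ Nat.div_le_self _ _
  have hER : E * R * 4 ≤ L :=
    calc E * R * 4 ≤ 5 * (K + 1) * R * 4 := by gcongr
      _ = 20 * (K + 1) * (L / (20 * (K + 1))) := by rw [hRd]; ring
      _ ≤ L := Nat.mul_div_le L _
  have h2X : 2 * (E * R + E + 1) ≤ L := by omega
  -- `2^X ≤ s`, `2 c^(R+1) ≤ 2^X`
  have hXs : 2 ^ (E * R + E + 1) ≤ Nat.sqrt m := by
    rw [Nat.le_sqrt, ← pow_add]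
    exact le_trans (Nat.pow_le_pow_right (by norm_num) (by omega)) h2L
  have hcR1 : pc k L ^ (R + 1) ≤ 2 ^ (E * R + E) :=
    calc pc k L ^ (R + 1) ≤ (2 ^ E) ^ (R + 1) := Nat.pow_le_pow_left hcE _
      _ = 2 ^ (E * R + E) := by rw [← pow_mul, mul_add_one]
  have hcRs : 2 * pc k L ^ (R + 1) ≤ Nat.sqrt m := by
    refine le_trans ?_ hXs
    have h22 : 2 ^ (E * R + E + 1) = 2 * 2 ^ (E * R + E) := by rw [pow_succ, mul_comm]
    rw [h22]
    exact Nat.mul_le_mul_left 2 hcR1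
  have hcpos : 0 < pc k L ^ (R + 1) := Nat.pow_pos (by omega)
  have hcc : pc k L ≤ pc k L ^ (R + 1) := Nat.le_self_pow (by omega) _
  -- `T' = m^k + 2R + 2 ≤ 2^((k+1)(L+1)+1)`
  have hT : m ^ k + 2 * R + 2 ≤ 2 ^ ((k + 1) * (L + 1) + 1) := by
    have h1 : m ^ k ≤ 2 ^ ((k + 1) * (L + 1)) :=
      calc m ^ k ≤ (2 ^ (L + 1)) ^ k := Nat.pow_le_pow_left hmL.le k
        _ = 2 ^ ((L + 1) * k) := by rw [← pow_mul]
        _ ≤ 2 ^ ((k + 1) * (L + 1)) := Nat.pow_le_pow_right (by norm_num)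
              (by rw [mul_comm (k + 1)]; exact Nat.mul_le_mul_left _ (Nat.le_succ k))
    have h2 : 2 * R + 2 ≤ 2 ^ ((k + 1) * (L + 1)) :=
      calc 2 * R + 2 ≤ 2 ^ L * 2 := by have := @Nat.lt_two_pow_self L; omega
        _ = 2 ^ (L + 1) := (pow_succ 2 L).symm
        _ ≤ 2 ^ ((k + 1) * (L + 1)) := Nat.pow_le_pow_right (by norm_num)
              (Nat.le_mul_of_pos_left (L + 1) (Nat.succ_pos k))
    rw [pow_succ]
    omega
  have hm1 : m + 1 ≤ 2 ^ (L + 1) := hmL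
  refine ⟨hr2, by omega, by omega, ?_, ?_, ?_, ?_, ?_⟩
  · -- `4 (r - 1) ≤ 4 r²`
    unfold pc
    exact Nat.mul_le_mul_left 4
      (le_trans (Nat.sub_le (pr k L) 1) (Nat.le_self_pow (by norm_num) (pr k L)))
  · -- (A)
    have hexp : (k + 1) * (L + 1) + 1 + (L + 1) * pl k L = pr k L := by rw [pr]
    have h2l : 2 * pl k L ^ 2 < pc k L := by
      have := Nat.pow_lt_pow_left hlr (n := 2) (by norm_num)
      unfold pc; omega
    calc (m ^ k + 2 * R + 2) * (m + 1) ^ pl k L * (pl k L ^ 2) ^ pr k L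
        ≤ 2 ^ ((k + 1) * (L + 1) + 1) * (2 ^ (L + 1)) ^ pl k L * (pl k L ^ 2) ^ pr k L := by
          gcongr
      _ = (2 * pl k L ^ 2) ^ pr k L := by rw [← pow_mul, ← pow_add, hexp, mul_pow]
      _ < pc k L ^ pr k L := Nat.pow_lt_pow_left h2l (by omega)
  · -- (B)
    have h1 : (pr k L - 1) ^ pl k L ≤ pr k L ^ pl k L :=
      Nat.pow_le_pow_left (Nat.sub_le (pr k L) 1) (pl k L)
    have h4 : 2 * 2 ^ ((k + 1) * (L + 1) + 1) ≤ 4 ^ (pl k L + 1) := by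
      rw [show (4 : ℕ) = 2 ^ 2 by norm_num, ← pow_mul, ← pow_succ']
      refine Nat.pow_le_pow_right (by norm_num) ?_
      unfold pl
      omega
    have hr1 : 1 < pr k L ^ 2 := Nat.one_lt_pow (by norm_num) (by omega)
    have hpos : 0 < 4 ^ (pl k L + 1) * (pr k L ^ pl k L) ^ 2 := by positivity
    calc 2 * ((m ^ k + 2 * R + 2) * ((pr k L - 1) ^ pl k L) ^ 2)
        ≤ 2 * (2 ^ ((k + 1) * (L + 1) + 1) * (pr k L ^ pl k L) ^ 2) := by gcongr
      _ = (2 * 2 ^ ((k + 1) * (L + 1) + 1)) * (pr k L ^ pl k L) ^ 2 := by ring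
      _ ≤ 4 ^ (pl k L + 1) * (pr k L ^ pl k L) ^ 2 := Nat.mul_le_mul_right _ h4
      _ < 4 ^ (pl k L + 1) * (pr k L ^ pl k L) ^ 2 * pr k L ^ 2 :=
          lt_mul_of_one_lt_right hpos hr1
      _ = pc k L ^ (pl k L + 1) := by unfold pc; rw [mul_pow, ← pow_mul, ← pow_mul]; ring
  · -- live-set budget
    rw [Nat.le_div_iff_mul_le hcpos]
    calc Nat.sqrt m * pc k L ^ (R + 1) ≤ Nat.sqrt m * Nat.sqrt m :=
          Nat.mul_le_mul_left _ (by omega)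
      _ ≤ m := Nat.sqrt_le m
  · -- colour budget
    have h1 : (R + 1) * pc k L ≤ pc k L ^ (R + 1) :=
      Literature.Barriers.PneNP.succ_mul_le_pow_succ_of_two_le hc2
    omega

/-- **T1 (the round's target, PROVED).** Every `(⌊√m⌋-1, ⌊√m⌋)`-clique function on `m`
vertices needs `m^k` gates over `{∧₂, ∨₂, ¬}` when at most `logBudget m = Θ(log m / log log m)`
NOT gates are allowed. -/
theorem cliqueLikeNegLimitedLog : ∀ k : ℕ, ∀ᶠ m : ℕ in Filter.atTop, ∀ F : (KEdge m → Bool) → Bool,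
    CliqueLike (univ : Finset (Fin m)) (Nat.sqrt m - 1) (Nat.sqrt m) F →
    ∀ C : Circuit (KEdge m), C.IsOver deMorganBasis → C.Computes F →
      C.negationCount ≤ logBudget m → m ^ k ≤ C.size := by
  intro k
  set K₀ := max (2 * (Nat.log 2 (k + 1) + 1) + 5) 8 with hK₀
  filter_upwards [Filter.eventually_ge_atTop (2 ^ 2 ^ K₀)] with m hm F hCL C hC hcomp hneg
  have hL : 2 ^ K₀ ≤ Nat.log 2 m := Nat.le_log_of_pow_le one_lt_two hm
  have hK : K₀ ≤ Nat.log 2 (Nat.log 2 m) := Nat.le_log_of_pow_le one_lt_two hL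
  have hRd : logBudget m = Nat.log 2 m / (20 * (Nat.log 2 (Nat.log 2 m) + 1)) := rfl
  obtain ⟨hr, hl, hls, h4, hA, hB, hsm, hRs⟩ := params_ok rfl rfl hRd hK
  exact le_size_of_cliqueLike_ab hr hl hls h4 hA hB hsm hRs F hCL C hC hcomp hneg

/-- **T2.** The case `F = CLIQUE(m, ⌊√m⌋)`. -/
theorem cliqueFnNegLimitedLog : ∀ k : ℕ, ∀ᶠ m : ℕ in Filter.atTop, ∀ C : Circuit (KEdge m),
    C.IsOver deMorganBasis → C.Computes (cliqueFn m (Nat.sqrt m)) →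
    C.negationCount ≤ logBudget m → m ^ k ≤ C.size := by
  intro k
  filter_upwards [cliqueLikeNegLimitedLog k, Filter.eventually_ge_atTop 1] with m hm hm1 C hC hcomp hneg
  exact hm _ (cliqueLike_cliqueFn (Nat.le_sqrt.2 (by simpa using hm1))) C hC hcomp hneg

end Summit.PneNP.PneNP.Theorems.NegLimLog
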